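import Mathlib
import HarnessLib
import Summits.BirchSwinnertonDyer.BirchSwinnertonDyer.Theses.ManinLocalTwoThree
import Summits.BirchSwinnertonDyer.BirchSwinnertonDyer.Theorems.ManinLocalTwoThreeKernelRowsRoad
import Literature.NumberTheory.EllipticCurves.KatoAdditiveTwistedValueNeronIntegralityTwoReal
import Literature.NumberTheory.EllipticCurves.KatoAdditiveTwistedValueNeronIntegralitySymbolClosure
import Literature.NumberTheory.EllipticCurves.ManinConstantGamma1Gamma0Comparison

/-!
# Lines/kato_gamma1_kernel_candidate.lean — CANDIDATE line (NOT registered; lead p1 gen 13, 2026-08-29): the KERNEL-ROW ROAD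
# An ALTERNATIVE to the line of record `kato_shift_two` v20 for the planner-of-record to weigh (an §76.8 (iii): «skeleton option, your call»; LEAD
# motivation: insurance against E-an-48's η-QUOTIENT form failing at 16 ∣ N, an g14 caveat / an g34 census).  SIX stubs instead of seven:
#   printed, by name: F♯ (`stub_katoFactTwoReal`), hex (`stub_existsOptimalGamma1Datum`), F-es-21♭K (`stub_katoFactTwoSymbolClosure`) — NO F★;
#   laws, inline, read on the CORE at 16 ∣ N on lattice-optimal a₁ = a₃ = 0 data: E-an-152 `ShimuraKernelBlindAtFour` body (`stub_shimuraKernelBlindOnCore`),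
#   E-an-152b `ShimuraIndexNeFourAtFour` body (`stub_shimuraIndexNeFourOnCore`), and Kato–Néron integrality at the X₁(N)-optimal curve of every REDUCIBLE
#   core class off the period-dominated locus (`stub_katoNeronIntegralTwoGamma1OptimalOnReducibleCore`) — NO E-an-48/53.
# TRADE-OFF vs v20: drops F★ and the η-quotient certificate; asks es's Kato law on ALL reducible core classes (v20: totally blind only) and an's two
# c-free Shimura-kernel rows (152: the kernel point at Shimura index 2 is a BLIND rational 2-torsion point; 152b: index ≠ 4).
# COMPOSITION = `maninOddAtFour_of_katoFact_of_levelSixteenCoreKernelRows` (lead p1 g13, `Theorems/ManinLocalTwoThreeKernelRowsRoad.lean`: S-an-65 POINTWISE +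
# Γ₁ lever + core-preserving rotation + p2's `maninOddAtFour_of_core`).  To adopt: `ledger skeleton check` this file `--crux stmt-BirchSwinnertonDyer-22967`
# and crux-write it over `Lines/kato_shift_two.lean` (or register as a second line if the planners prefer two).
# HONEST FRAMING: CONDITIONAL reduction; the three laws are OPEN; BSD is not proved; Manin's conjecture is not proved; C2 OPEN.
-/

set_option autoImplicit false
set_option linter.dupNamespace false

noncomputable section

open scoped Classical MatrixGroups ModularForm NumberField
open IsDedekindDomain IsDedekindDomain.HeightOneSpectrum Rat.HeightOneSpectrum
open PowerSeries CongruenceSubgroup WeierstrassCurve Literature.NumberTheory.EllipticCurves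
  Literature.NumberTheory.EllipticCurves.ModularForms
  Literature.RingTheory.FormalGroups
  Summit.BirchSwinnertonDyer.Rank1Residual.ManinAdditive
  Summit.BirchSwinnertonDyer.Rank1Residual.ManinAdditive.CuspidalKummer
  Summit.BirchSwinnertonDyer.Rank1Residual.ManinAdditive.ShimuraLedger

namespace Summit.BirchSwinnertonDyer.BirchSwinnertonDyer.Cruxes.ManinOddAtFour.KatoGammaOneKernel

/-- STUB 1 — F♯ BY NAME (Literature, statement-only; Kato 2004, real-subfield reading): the irreducible locus through the X₁-optimal curve. -/
theorem stub_katoFactTwoReal : kato_neron_isIntegral_twistedSymbolSum_of_additive_two_real := by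
  sorry

/-- STUB 2 — hex BY NAME (Literature, statement-only; Stevens 1989 §2 / CES 2003 §6.1): Stevens' optimal X₁(N)-datum in every class. -/
theorem stub_existsOptimalGamma1Datum : exists_optimal_gamma1ParametrizationData := by
  sorry

/-- STUB 3 — F-es-21♭K BY NAME (Literature, statement-only; Kato at Kato's curve, Wuthrich §3): the period-dominated excuse. -/
theorem stub_katoFactTwoSymbolClosure : kato_isIntegral_twistedSymbolSum_two_symbolClosure := by
  sorry

/-- STUB 4 — E-an-152 READ ON THE CORE AT `16 ∣ N` (an's `ShimuraKernel.ShimuraKernelBlindAtFour` body VERBATIM with `2 ^ 2 ∣ N` ↦ `2 ^ 4 ∣ N` and the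
binders `v₂(j) < 1`, core added): at Shimura index 2 the kernel point is a Kummer-blind rational 2-torsion point (c-free; OPEN). -/
theorem stub_shimuraKernelBlindOnCore :
    ∀ (W : WeierstrassCurve ℚ) [W.IsElliptic] [W.IsGloballyMinimal] {N : ℕ} [NeZero N]
      (D : ModularParametrizationData W N),
      (∀ z ∈ D.L.lattice, ∃ w ∈ periodLattice D.f, z = D.c * w) → 2 ^ 4 ∣ N → W.a₁ = 0 → W.a₃ = 0 →
      ((primesEquiv (R := 𝓞 ℚ)).symm ⟨2, Nat.prime_two⟩).valuation ℚ W.j < 1 → (∀ d : ℤ, d = -1 ∨ d = 2 ∨ d = -2 → 2 ≤ (W.quadraticTwist (d : ℚ)).conductorExponent ((primesEquiv (R := ℤ)).symm ⟨2, Nat.prime_two⟩)) →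
      (periodLatticeGamma1 D.f ≠ periodLattice D.f →
        ∀ w ∈ periodLatticeGamma1 D.f, (∀ v ∈ periodLattice D.f, w ≠ 2 * v) →
          ∃ A₂ A₄ E : ℤ, (A₂ : ℚ) = W.a₂ ∧ (A₄ : ℚ) = W.a₄ ∧
            (E : ℚ) ^ 3 + W.a₂ * (E : ℚ) ^ 2 + W.a₄ * E + W.a₆ = 0 ∧
            D.L.weierstrassP ((D.c : ℂ) * w / 2) = (((E : ℚ) + W.a₂ / 3 : ℚ) : ℂ) ∧ KummerBlindAtTwo A₂ A₄ E) := by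
  sorry

/-- STUB 5 — E-an-152b READ ON THE CORE AT `16 ∣ N` (an's `ShimuraKernel.ShimuraIndexNeFourAtFour` body, same changes): the Shimura index is never 4
(c-free; OPEN). -/
theorem stub_shimuraIndexNeFourOnCore :
    ∀ (W : WeierstrassCurve ℚ) [W.IsElliptic] [W.IsGloballyMinimal] {N : ℕ} [NeZero N]
      (D : ModularParametrizationData W N),
      (∀ z ∈ D.L.lattice, ∃ w ∈ periodLattice D.f, z = D.c * w) → 2 ^ 4 ∣ N → W.a₁ = 0 → W.a₃ = 0 →
      ((primesEquiv (R := 𝓞 ℚ)).symm ⟨2, Nat.prime_two⟩).valuation ℚ W.j < 1 → (∀ d : ℤ, d = -1 ∨ d = 2 ∨ d = -2 → 2 ≤ (W.quadraticTwist (d : ℚ)).conductorExponent ((primesEquiv (R := ℤ)).symm ⟨2, Nat.prime_two⟩)) →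
      (¬ (∀ z : ℂ, z ∈ periodLatticeGamma1 D.f ↔ ∃ w ∈ periodLattice D.f, z = 2 * w)) := by
  sorry

/-- STUB 6 — E-es-110 READ ON {`16 ∣ N`} ∩ {off period-dominated} ∩ {REDUCIBLE core class}: Kato–Néron integrality `KatoFactTwoAt V D₁.f` at every optimal
X₁(N)-curve with `16 ∣ N`, not period-dominated by a globally minimal symbol-closure relative, whose class contains a lattice-optimal a₁ = a₃ = 0 core datum
with a rational 2-torsion point (OPEN law; larger habitat than v20's 6♭‴, which asks it on totally blind classes only). -/
theorem stub_katoNeronIntegralTwoGamma1OptimalOnReducibleCore :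
    ∀ (V : WeierstrassCurve ℚ) [V.IsElliptic] [V.IsGloballyMinimal] {N : ℕ} [NeZero N]
      (D₁ : Gamma1ParametrizationData V N), D₁.IsOptimal → 2 ^ 4 ∣ N →
      (¬ ∃ (V' : WeierstrassCurve ℚ) (_ : V'.IsElliptic) (_ : V'.IsGloballyMinimal) (q m : ℤ),
        Odd q ∧ WeierstrassCurve.IsIsogenous V' V ∧ (q : ℝ) * V'.realPeriodRat = (m : ℝ) * V.realPeriodRat ∧
        IsSymbolClosureCurve V' D₁.f) →
      (∃ (W₀ : WeierstrassCurve ℚ) (_ : W₀.IsElliptic) (_ : W₀.IsGloballyMinimal) (D₀ : ModularParametrizationData W₀ N),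
        IsIsogenous V W₀ ∧ (∀ z ∈ D₀.L.lattice, ∃ w ∈ periodLattice D₀.f, z = D₀.c * w) ∧
        W₀.a₁ = 0 ∧ W₀.a₃ = 0 ∧ HasRationalTwoTorsion W₀ ∧
        ((primesEquiv (R := 𝓞 ℚ)).symm ⟨2, Nat.prime_two⟩).valuation ℚ W₀.j < 1 ∧ (∀ d : ℤ, d = -1 ∨ d = 2 ∨ d = -2 → 2 ≤ (W₀.quadraticTwist (d : ℚ)).conductorExponent ((primesEquiv (R := ℤ)).symm ⟨2, Nat.prime_two⟩))) →
      KatoFactTwoAt V D₁.f := by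
  sorry

/-- COMPOSITION (no sorry): the lead's `maninOddAtFour_of_katoFact_of_levelSixteenCoreKernelRows` (p1 g13). -/
theorem ManinOddAtFour_of :
    Summit.BirchSwinnertonDyer.BirchSwinnertonDyer.Theses.ManinLocalTwoThree.ManinOddAtFour :=
  Summit.BirchSwinnertonDyer.BirchSwinnertonDyer.Theorems.ManinLocalTwoThree.maninOddAtFour_of_katoFact_of_levelSixteenCoreKernelRows
    stub_katoFactTwoReal stub_existsOptimalGamma1Datum stub_katoFactTwoSymbolClosure
    stub_shimuraKernelBlindOnCore stub_shimuraIndexNeFourOnCore stub_katoNeronIntegralTwoGamma1OptimalOnReducibleCore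

end Summit.BirchSwinnertonDyer.BirchSwinnertonDyer.Cruxes.ManinOddAtFour.KatoGammaOneKernel

end
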